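import Summits.QuantumFields.Balaban3D.Proofs.UVStability3DInputs

/-!
# Route «BalabanUVNodes», Track-A DAG node N08 = [Balaban1985UV3] Thm 1 p. 257 ∕ Thm 2 p. 272 — THE [B1] (3.24) ROW OF THE d = 3 LANE'S (α) INPUTS IN
# ITS SOURCE-FAITHFUL (OUTPUT-SANDWICH) SHAPE, part 1 of 2: THE SUPPLIERS — rows C3 `cumulant58` ∕ C4 `cumulantLower` at the torus-block carrier and at
# the lane's pieces from ONE `B1Sect3Statements.Eq324` row (part 2 = `…N08AlphaEq324Row`: the edited clause `StepAlphaEq324` ∕ `RunAlphaEq324` and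
# the lane's END THEOREM re-derived)

Cell `pub-ymgap`, seat `pub-ymgap-dag-n08-w4` gen 0 (WIDTH SEAT 4∕4 on N08 under HUMAN RULING D-0149 ∕ director-ym №197; item = dag-n08-d's LOCATED
«(α)-schema CURRENCY MISMATCH #3» (`HOME/pub-ymgap-dag-n08-d/N08-ALPHA-LOCATED-g7.md` §2, g9), worded to this seat by dag-lead g13 DEDUP-354 (R-W4)).
`bears_on: R4∕N08`; filed `--supports stmt-QuantumFields-20542` (K1⁷).  THEOREMS ONLY (def-free, sorry-free, standard axioms); the lane's
`Summits/QuantumFields/Balaban3D/Proofs/*` files are consumed BY NAME and left untouched.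

THE LOCATED POINT.  In the d = 3 lane's (α) input list (`Balaban3D.Proofs.UVStability3DInputs.StepAlpha`, = gen 0's DATA schema
`…N08AlphaClassI.StepDataRows`) the [Balaban1982Higgs1] (3.24) input sits as TWO rows in the TILTED currency: (a) `h324a` (the small-field volume of the
box, `|log μ(box)| ≤ Ca·rem`) and (c) `h324c` (the cgf-DERIVATIVE bound `sup_{t∈[0,1]} |∂ₜ^{n̄+1} log ∫ e^{t𝒱} d(χμ)| ≤ Cc·(n̄+1)!·rem`), consumed only
through Taylor–Lagrange (`Balaban3D.Proofs.eq324_indicator_of_measurableSet`) to produce the printed OUTPUT sandwich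
`B1Sect3Statements.Eq324 ⟨χe^{𝒱}⟩ (⟨𝒱ⁿ⟩ᵀ)ₙ n̄ C (Lᵏε) (3+κ₀) |T₁^{(k)}|` — «⟨χ exp(V)⟩ = exp[⟨V⟩ + … + (1∕n̄!)⟨V^{n̄}⟩ᵀ + O(εᵏ)|T₁|]» ([B1] (3.24)
p. 616).  The row's only printed SOURCE — the lemma of [BenfattoEtAl1978] p. 152 via [B1] p. 616 («we will rely on the results of Benfatto et al. [2]») —
delivers exactly this output sandwich (tree: `B1Eq324BenfattoSpecialisation.abs_log_integral_sub_cumulantSum_le`) and says nothing about tilted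
cumulants; and the lane itself proves the two cuts interchangeable at the leaf (`Balaban3D.Proofs.Cumulant324.cumulant58_of_eq324(_model)`,
`eq324_of_lqb_leaves`; `Run3Cumulant.cumulant58_of_graphRep23'` is already cut at `Eq324`).  This file supplies rows C3∕C4 from the `Eq324`-shaped row:
* §1 (torus-block carrier, p1's `Carriers.seriesPieces`, STANDARD FORM of `Run3StepCumulant.…_std`): `cumulant58_series_std_of_eq324`,
  `cumulantLower_series_std_of_eq324` — rows C3∕C4 from G3D-02 + R-ACT + (25) + ONE `Eq324` row for `lhs = ∫_{box} e^{𝒱} dμ` with the data's own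
  cumulants `(𝔖 k).cum`, the run slots (`hZ`, `hR`, `hlarge`) discharged exactly as in the lane's `_std` theorems.
* §2 (the lane's pieces `Inputs.pieces 𝔎 X 𝔖 k`): `cumulant58_pieces_of_eq324`, `cumulantLower_pieces_of_eq324` — twins of
  `AlphaCumulant.cumulant58_pieces` ∕ `cumulantLower_pieces` with `h324a` + `h324c` ↦ `h324`.
HONEST SCOPE.  Application bookkeeping (one application of a lane theorem each + the lane's own arithmetic); every analytic input is a displayed
hypothesis; nothing is decided about the TRUTH of the (3.24) row for Bałaban's expansion data (the cluster expansion = N08's object gap, class II of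
`HOME/pub-ymgap-dag-n08-b/N08-ALPHA-ROWS.md` §2); not a defect of any landed module.  Count-neutral; N08 NOT discharged;
`B1Eq324BenfattoLemma.BasicLemmaPrinted` untouched (the [2]-line pens'); one finite 𝕋⁴ programme at fixed ε with d = 3 tori of [B10] inside the record,
Bałaban AS PRINTED; nothing about d = 4 continuum limits, OS axioms, a mass gap or the Clay problem — R4 closes the conditional finite-𝕋⁴ rung
`BalabanLadder.UV` only.

References: [Balaban1985UV3] T. Bałaban, Commun. Math. Phys. 102 (1985) 255–275 — (24) p. 262, (58)–(59) p. 270, (37) p. 265; [Balaban1982Higgs1]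
T. Bałaban, Commun. Math. Phys. 85 (1982) 603–636 — (3.24) p. 616; [BenfattoEtAl1978] G. Benfatto et al., Commun. Math. Phys. 59 (1978) 143–166 — Lemma p. 152.
-/

noncomputable section

namespace Summit.QuantumFields.YangMills.Theorems.BalabanUVNodesN08AlphaEq324RowSuppliers

open MeasureTheory Metric
open scoped BigOperators Nat Matrix.Norms.L2Operator
open Literature.MathematicalPhysics.QuantumFieldTheory.Balaban1983to89
open Literature.MathematicalPhysics.QuantumFieldTheory.Balaban1983to89.B10
open Literature.MathematicalPhysics.QuantumFieldTheory.Balaban1983to89.B10SectAGathering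
open Literature.MathematicalPhysics.QuantumFieldTheory.Balaban1983to89.B10SectCExpansion (Bound44)
open Literature.MathematicalPhysics.QuantumFieldTheory.Balaban1983to89.B10Eq24Cumulant (chiMeasure truncExp)
open Literature.MathematicalPhysics.QuantumFieldTheory.Balaban1983to89.B12TreeDecay (kappa₀ K₀)
open Literature.MathematicalPhysics.QuantumFieldTheory.Balaban1983to89.TreeLengthTorus (tsys tcubeSys)
open Literature.MathematicalPhysics.QuantumFieldTheory.Balaban1983to89.B1Sect3Statements (Eq324)
open Literature.MathematicalPhysics.QuantumFieldTheory.Balaban1985CMP102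
open Literature.MathematicalPhysics.QuantumFieldTheory.Balaban1985CMP102.Setting
open Literature.MathematicalPhysics.QuantumFieldTheory.Balaban1985CMP102.Theorems
open Literature.MathematicalPhysics.QuantumFieldTheory.Balaban1985CMP102.Binders
  (ChartAnalyticityAsCited FarTermsDecayAsCited Norm35StepAsCited LogZTExtensiveAsCited LogZLocalizedAsCited GraphTerms GraphRep23AsCited)
open Literature.MathematicalPhysics.QuantumFieldTheory.Balaban1985CMP102.BindersNewborn (NewbornTerms45AsCited)
open Summit.QuantumFields.Balaban3D.Carriers
open Summit.QuantumFields.Balaban3D.Proofs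
open Summit.QuantumFields.Balaban3D.Proofs.ScalesArithmetic
open Summit.QuantumFields.Balaban3D.Proofs.Constants
open Summit.QuantumFields.Balaban3D.Proofs.UVStability3D
open Summit.QuantumFields.Balaban3D.Proofs.EndTheorem
open Summit.QuantumFields.Balaban3D.Proofs.Inputs
open Summit.QuantumFields.Balaban3D.Proofs.Residuals
open Summit.QuantumFields.Balaban3D.Proofs.Primitives
open Summit.QuantumFields.Balaban3D.Proofs.Family (small28 gk_le_gamma46 gk_le_gammaOO gk_le_gamma71 prov_hb₁ prov_hb₂)
open Summit.QuantumFields.Balaban3D.Proofs.Representation33 (jet26)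
open Summit.QuantumFields.Balaban3D.Proofs.Newborn46 (newborn46_std)
open Summit.QuantumFields.Balaban3D.Proofs.Bound55Std (Fibre49 Fibre57Low hint_std hint47_std)
open Summit.QuantumFields.Balaban3D.Proofs.LiftBridge (liftCfg)
open Summit.QuantumFields.Balaban3D.Proofs.Run3SmallFactors (codeZ)
open Summit.QuantumFields.Balaban3D.Proofs.GroupModelLieC (lieC)
open Summit.QuantumFields.Balaban3D.Proofs.UVStability3DInputs
open B7Prop1Explicit (hol plaqWord)
open B7Prop1Local (pdevOn loK plaqHiK)
open B7Prop2Explicit (avgIter)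

variable {L : ℕ}

/-! ## §1 Rows C3∕C4 at the torus-block carrier `seriesPieces`, STANDARD FORM, from ONE `Eq324` row -/

section Series

variable {S : Scales L} {G : Type} [GaugeGroup G] [MeasurableSpace G] [HaarData G]
  {V : Type} [NormedAddCommGroup V] [NormedSpace ℂ V] {Nc : ℕ → ℕ} [∀ k, NeZero (Nc k)]

/-- **Row C3 `cumulant58` AT `seriesPieces` — STANDARD FORM, SOURCE-FAITHFUL (3.24) ROW.**  As the lane's `Run3StepCumulant.cumulant58_series_std`,
but the two tilted (3.24) inputs (a) `h324a`, (c) `h324c` are replaced by ONE row of the printed shape: `h324 : Eq324 (∫_{box h} e^{𝒱 h U} dμ)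
((𝔖 k).cum h U) n̄ C₂ (Lᵏg₀²) (3+κ₀) |T₁^{(k)}|` («⟨χe^V⟩ = exp[Σ_{n≤n̄}⟨Vⁿ⟩ᵀ∕n! + O(ε^κ)|T₁|]»); G3D-02 `hG` + R-ACT `hact`, (25) for `act`
(`h25`) and the run slots as there.  Constants OUT: `Cz = C·K₀(32,6)`, `C₁ = 0 + C·K₀(32,6)·e^{−R₁} + C₂`.  One application of the lane's
`Run3Cumulant.cumulant58_of_graphRep23'`. [cite: Balaban1985UV3, (24) p.262 + (58)–(59) p.270; Balaban1982Higgs1, (3.24) p.616] -/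
theorem cumulant58_series_std_of_eq324 (B : TowerBase S G) (𝔖 : ∀ k, StepSeries S G V (Nc k) k) (Cp : ∀ k, PiecesParams S k) (k : ℕ)
    [DecidableEq (tsys 3 (𝔖 k).Nblk).Dom] [IsProbabilityMeasure (𝔖 k).μ] {κ C : ℝ}
    (hκ : kappa₀ (4 * 2 ^ 3) (2 * 3) + 1 ≤ κ) (hC : 0 ≤ C) {C₂₃ c M₁ δ₀ : ℝ}
    (hact : ∀ h X U, ((𝔖 k).Gt h).activities.act X U = (𝔖 k).act h X U) {nbar : ℕ} {C₂ : ℝ}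
    (h324 : ∀ h (U : GaugeField S.P (k + 1) G),
      Eq324 (∫ ω in (𝔖 k).box h, Real.exp ((𝔖 k).𝒱 h U ω) ∂(𝔖 k).μ) ((𝔖 k).cum h U) nbar C₂
        ((L : ℝ) ^ k * S.g0sq) (3 + B.κ₀) (S.sites k))
    (hC₂ : 0 ≤ C₂) (hk : k ≤ S.K) (hκ₀ : 0 < B.κ₀) {r₀ R₁ : ℝ} (hr₀ : 1 ≤ r₀) (hR₁ : 6 + 2 * B.κ₀ ≤ R₁)
    (hrem : (Cp k).rem = ((L : ℝ) ^ k * S.g0sq) ^ (3 + B.κ₀) * S.sites k)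
    (hRret : B.Rret k = R₁ * B10.rFun r₀ (S.gk k))
    (hblocks : ((𝔖 k).Nblk : ℝ) ^ 3 ≤ S.sites k)
    (hG : ∀ h, GraphRep23AsCited ((𝔖 k).Gt h) (fun U => ∑ n ∈ Finset.Icc 1 nbar, (𝔖 k).cum h U n / (n ! : ℝ))
      C₂₃ c M₁ δ₀)
    (h25 : ∀ h, B10.Bound25Printed
      ⟨(tsys 3 (𝔖 k).Nblk).Dom, GaugeField S.P (k + 1) G, (tsys 3 (𝔖 k).Nblk).dj, (𝔖 k).act h⟩ (S.gk k) κ C) :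
    Cumulant58 (seriesPieces B 𝔖 Cp k) (C * K₀ (4 * 2 ^ 3) (2 * 3))
      (0 + C * K₀ (4 * 2 ^ 3) (2 * 3) * Real.exp (-R₁) + C₂) := by
  have hZ : ∀ h, (((Finset.univ : Finset (tcubeSys 3 (𝔖 k).Nblk).Cube) \ ΩblkOf (P := S.P) B.M₁ B.Rcol (Nc k) h).card : ℝ)
      ≤ (seriesPieces B 𝔖 Cp k).Zvol h := fun h => by
    show _ ≤ ((ZVol B.M₁ B.Rcol (k + 1) h k : ℕ) : ℝ)
    exact_mod_cast card_compl_ΩblkOf_le_ZVol (P := S.P) B.M₁ B.Rcol (Nc k) h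
  have hg : 0 < S.gk k := gk_pos S k
  have hg1 : S.gk k ≤ 1 := gk_le_one S S.gK_le_one k hk
  have hK₀ : 0 ≤ K₀ (4 * 2 ^ 3) (2 * 3) := (B12TreeDecay.K₀_pos _ _).le
  have hR : 0 ≤ B.Rret k := by
    rw [hRret]; exact mul_nonneg (by linarith) (VacuumAndBooking.rFun_nonneg r₀ (S.gk k) hg hg1)
  have hlarge : (C * S.gk k * K₀ (4 * 2 ^ 3) (2 * 3) * ((𝔖 k).Nblk : ℝ) ^ 3) * Real.exp (-B.Rret k) ≤
      (C * K₀ (4 * 2 ^ 3) (2 * 3) * Real.exp (-R₁)) * (Cp k).rem := by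
    have h := largeLoc_le_normRem S (r₀ := r₀) (R₁ := R₁) (κ₀ := B.κ₀) (A := C * K₀ (4 * 2 ^ 3) (2 * 3))
      (vol := ((𝔖 k).Nblk : ℝ) ^ 3) k hk hr₀ (by linarith) (by linarith) (mul_nonneg hC hK₀) (by positivity) hblocks
    rw [hRret, hrem, ScalesArithmetic.norm_rem_eq]
    calc C * S.gk k * K₀ (4 * 2 ^ 3) (2 * 3) * ((𝔖 k).Nblk : ℝ) ^ 3 * Real.exp (-(R₁ * B10.rFun r₀ (S.gk k)))
        = C * K₀ (4 * 2 ^ 3) (2 * 3) * S.gk k * ((𝔖 k).Nblk : ℝ) ^ 3 * Real.exp (-(R₁ * B10.rFun r₀ (S.gk k))) := by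
          ring
      _ ≤ C * K₀ (4 * 2 ^ 3) (2 * 3) * Real.exp (-R₁) * ((S.gk k ^ 2) ^ (3 + B.κ₀) * S.sites k) := h
  have hlogFl : ∀ (h : Hist S.P (k + 1)) (U : GaugeField S.P (k + 1) G), (seriesPieces B 𝔖 Cp k).logFl h U =
      Real.log (∫ ω in (𝔖 k).box h, Real.exp ((𝔖 k).𝒱 h U ω) ∂(𝔖 k).μ) := fun _ _ => rfl
  have hPprU : ∀ (h : Hist S.P (k + 1)) (U : GaugeField S.P (k + 1) G), (seriesPieces B 𝔖 Cp k).PprU h U =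
      ∑ X ∈ Finset.univ.filter (fun X : (tsys 3 (𝔖 k).Nblk).Dom =>
        (tcubeSys 3 (𝔖 k).Nblk).cubes X ⊆ ΩblkOf (P := S.P) B.M₁ B.Rcol (Nc k) h ∧ (tsys 3 (𝔖 k).Nblk).dj X < B.Rret k),
          (𝔖 k).act h X U := fun _ _ => rfl
  exact cumulant58_of_graphRep23' (𝔖 k).Nblk (seriesPieces B 𝔖 Cp k) hκ (𝔖 k).Gt (𝔖 k).act hact
    (fun h U => ∫ ω in (𝔖 k).box h, Real.exp ((𝔖 k).𝒱 h U ω) ∂(𝔖 k).μ) (𝔖 k).cum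
    (fun h => ΩblkOf (P := S.P) B.M₁ B.Rcol (Nc k) h) hG h25
    (fun h U => by rw [hlogFl h U, zero_mul, add_zero]) h324 hC₂ (le_of_eq hrem.symm) hR (mul_nonneg hC hg.le)
    (fun h U => by rw [hPprU h U, sum_filter_and_eq]) hZ hlarge

/-- **Row C4 `cumulantLower` AT `seriesPieces` — STANDARD FORM, SOURCE-FAITHFUL (3.24) ROW** (lower direction at the trivial history; the `Eq324` row is
read there only; `C₁' = C₁`).  One application of the lane's `Cumulant59.cumulantLower_torus`.
[cite: Balaban1985UV3, (37) p.265 + p.272 + (59) p.270; Balaban1982Higgs1, (3.24) p.616] -/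
theorem cumulantLower_series_std_of_eq324 (B : TowerBase S G) (𝔖 : ∀ k, StepSeries S G V (Nc k) k) (Cp : ∀ k, PiecesParams S k) (k : ℕ)
    [DecidableEq (tsys 3 (𝔖 k).Nblk).Dom] [IsProbabilityMeasure (𝔖 k).μ] {κ C : ℝ}
    (hκ : kappa₀ (4 * 2 ^ 3) (2 * 3) + 1 ≤ κ) (hC : 0 ≤ C) {C₂₃ c M₁ δ₀ : ℝ}
    (hact : ∀ h X U, ((𝔖 k).Gt h).activities.act X U = (𝔖 k).act h X U) {nbar : ℕ} {C₂ : ℝ}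
    (h324 : ∀ h (U : GaugeField S.P (k + 1) G),
      Eq324 (∫ ω in (𝔖 k).box h, Real.exp ((𝔖 k).𝒱 h U ω) ∂(𝔖 k).μ) ((𝔖 k).cum h U) nbar C₂
        ((L : ℝ) ^ k * S.g0sq) (3 + B.κ₀) (S.sites k))
    (hC₂ : 0 ≤ C₂) (hk : k ≤ S.K) (hκ₀ : 0 < B.κ₀) {r₀ R₁ : ℝ} (hr₀ : 1 ≤ r₀) (hR₁ : 6 + 2 * B.κ₀ ≤ R₁)
    (hrem : (Cp k).rem = ((L : ℝ) ^ k * S.g0sq) ^ (3 + B.κ₀) * S.sites k)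
    (hRret : B.Rret k = R₁ * B10.rFun r₀ (S.gk k))
    (hblocks : ((𝔖 k).Nblk : ℝ) ^ 3 ≤ S.sites k)
    (hG : ∀ h, GraphRep23AsCited ((𝔖 k).Gt h) (fun U => ∑ n ∈ Finset.Icc 1 nbar, (𝔖 k).cum h U n / (n ! : ℝ))
      C₂₃ c M₁ δ₀)
    (h25 : ∀ h, B10.Bound25Printed
      ⟨(tsys 3 (𝔖 k).Nblk).Dom, GaugeField S.P (k + 1) G, (tsys 3 (𝔖 k).Nblk).dj, (𝔖 k).act h⟩ (S.gk k) κ C) :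
    CumulantLower (seriesPieces B 𝔖 Cp k) (0 + C * K₀ (4 * 2 ^ 3) (2 * 3) * Real.exp (-R₁) + C₂) := by
  have hZ : ∀ h, (((Finset.univ : Finset (tcubeSys 3 (𝔖 k).Nblk).Cube) \ ΩblkOf (P := S.P) B.M₁ B.Rcol (Nc k) h).card : ℝ)
      ≤ (seriesPieces B 𝔖 Cp k).Zvol h := fun h => by
    show _ ≤ ((ZVol B.M₁ B.Rcol (k + 1) h k : ℕ) : ℝ)
    exact_mod_cast card_compl_ΩblkOf_le_ZVol (P := S.P) B.M₁ B.Rcol (Nc k) h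
  have hg : 0 < S.gk k := gk_pos S k
  have hg1 : S.gk k ≤ 1 := gk_le_one S S.gK_le_one k hk
  have hK₀ : 0 ≤ K₀ (4 * 2 ^ 3) (2 * 3) := (B12TreeDecay.K₀_pos _ _).le
  have hR : 0 ≤ B.Rret k := by
    rw [hRret]; exact mul_nonneg (by linarith) (VacuumAndBooking.rFun_nonneg r₀ (S.gk k) hg hg1)
  have hlarge : (C * S.gk k * K₀ (4 * 2 ^ 3) (2 * 3) * ((𝔖 k).Nblk : ℝ) ^ 3) * Real.exp (-B.Rret k) ≤
      (C * K₀ (4 * 2 ^ 3) (2 * 3) * Real.exp (-R₁)) * (Cp k).rem := by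
    have h := largeLoc_le_normRem S (r₀ := r₀) (R₁ := R₁) (κ₀ := B.κ₀) (A := C * K₀ (4 * 2 ^ 3) (2 * 3))
      (vol := ((𝔖 k).Nblk : ℝ) ^ 3) k hk hr₀ (by linarith) (by linarith) (mul_nonneg hC hK₀) (by positivity) hblocks
    rw [hRret, hrem, ScalesArithmetic.norm_rem_eq]
    calc C * S.gk k * K₀ (4 * 2 ^ 3) (2 * 3) * ((𝔖 k).Nblk : ℝ) ^ 3 * Real.exp (-(R₁ * B10.rFun r₀ (S.gk k)))
        = C * K₀ (4 * 2 ^ 3) (2 * 3) * S.gk k * ((𝔖 k).Nblk : ℝ) ^ 3 * Real.exp (-(R₁ * B10.rFun r₀ (S.gk k))) := by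
          ring
      _ ≤ C * K₀ (4 * 2 ^ 3) (2 * 3) * Real.exp (-R₁) * ((S.gk k ^ 2) ^ (3 + B.κ₀) * S.sites k) := h
  have hlogFl : ∀ (h : Hist S.P (k + 1)) (U : GaugeField S.P (k + 1) G), (seriesPieces B 𝔖 Cp k).logFl h U =
      Real.log (∫ ω in (𝔖 k).box h, Real.exp ((𝔖 k).𝒱 h U ω) ∂(𝔖 k).μ) := fun _ _ => rfl
  have hPprU : ∀ (h : Hist S.P (k + 1)) (U : GaugeField S.P (k + 1) G), (seriesPieces B 𝔖 Cp k).PprU h U =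
      ∑ X ∈ Finset.univ.filter (fun X : (tsys 3 (𝔖 k).Nblk).Dom =>
        (tcubeSys 3 (𝔖 k).Nblk).cubes X ⊆ ΩblkOf (P := S.P) B.M₁ B.Rcol (Nc k) h ∧ (tsys 3 (𝔖 k).Nblk).dj X < B.Rret k),
          (𝔖 k).act h X U := fun _ _ => rfl
  exact cumulantLower_torus (𝔖 k).Nblk (seriesPieces B 𝔖 Cp k) hκ
    (fun h U => ∫ ω in (𝔖 k).box h, Real.exp ((𝔖 k).𝒱 h U ω) ∂(𝔖 k).μ) (𝔖 k).cum (𝔖 k).act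
    (fun h => ΩblkOf (P := S.P) B.M₁ B.Rcol (Nc k) h)
    (fun U => by rw [hlogFl, zero_mul, sub_zero]) (fun U => h324 _ U) hC₂ (le_of_eq hrem.symm) hR (mul_nonneg hC hg.le) h25
    (fun h U => by rw [(hG h).cum_eq_sum_activities U]; exact Finset.sum_congr rfl fun X _ => hact h X U)
    (fun h U => by rw [hPprU h U, sum_filter_and_eq]) hZ hlarge

end Series

/-! ## §2 Rows C3∕C4 at the lane's pieces `Inputs.pieces 𝔎 X 𝔖 k` from ONE `Eq324` row -/

section Pieces

variable (𝔎 : LaneConsts L) {S : Scales L} {G : Type} [GaugeGroup G] [MeasurableSpace G] [HaarData G]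
  {V : Type} [NormedAddCommGroup V] [NormedSpace ℂ V]
  (X : ExternalInputs S G) (𝔖 : ∀ k, StepSeries S G V (nblkOf S 𝔎.carrier k) k) (k : ℕ)

open Classical in
/-- **Row C3 AT THE LANE'S PIECES from the source-faithful (3.24) row** — twin of `AlphaCumulant.cumulant58_pieces` with `h324a` + `h324c` replaced by
`h324 : Eq324 (∫_{box} e^{𝒱} dμ) ((𝔖 k).cum h U) n̄ C₂ (Lᵏg₀²) (3+κ₀) |T₁^{(k)}|` and the record's `C₁ = 0 + C25·K₀(32,6)·e^{−R₁} + C₂`.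
[cite: Balaban1985UV3, (24) p.262 + (58)–(59) p.270; Balaban1982Higgs1, (3.24) p.616] -/
theorem cumulant58_pieces_of_eq324 (hk : k + 1 ≤ S.K) (hμ : IsProbabilityMeasure (𝔖 k).μ) {κ C25 : ℝ}
    (hκ : kappa₀ (4 * 2 ^ 3) (2 * 3) + 1 ≤ κ) (hC25 : 0 ≤ C25) (hr₀ : 1 ≤ 𝔎.F.r₀) (hR₁ : 6 + 2 * 𝔎.F.κ₀ ≤ 𝔎.F.R₁)
    {C₂₃ c M₁ δ₀ : ℝ} {nbar : ℕ} {C₂ : ℝ} (hC₂ : 0 ≤ C₂)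
    (hCz : 𝔎.sc.Cz = C25 * K₀ (4 * 2 ^ 3) (2 * 3))
    (hC₁ : 𝔎.sc.C₁ = 0 + C25 * K₀ (4 * 2 ^ 3) (2 * 3) * Real.exp (-𝔎.F.R₁) + C₂)
    (hact : ∀ h Y U, ((𝔖 k).Gt h).activities.act Y U = (𝔖 k).act h Y U)
    (h324 : ∀ h (U : GaugeField S.P (k + 1) G),
      Eq324 (∫ ω in (𝔖 k).box h, Real.exp ((𝔖 k).𝒱 h U ω) ∂(𝔖 k).μ) ((𝔖 k).cum h U) nbar C₂
        ((L : ℝ) ^ k * S.g0sq) (3 + 𝔎.F.κ₀) (S.sites k))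
    (hG : ∀ h, GraphRep23AsCited ((𝔖 k).Gt h) (fun U => ∑ n ∈ Finset.Icc 1 nbar, (𝔖 k).cum h U n / (n ! : ℝ)) C₂₃ c M₁ δ₀)
    (h25 : ∀ h, Bound25Printed ⟨(tsys 3 (𝔖 k).Nblk).Dom, GaugeField S.P (k + 1) G, (tsys 3 (𝔖 k).Nblk).dj, (𝔖 k).act h⟩
      (S.gk k) κ C25) :
    Cumulant58 (pieces 𝔎 X 𝔖 k) 𝔎.sc.Cz 𝔎.sc.C₁ := by
  haveI := hμ
  rw [hCz, hC₁]
  exact cumulant58_series_std_of_eq324 (X.toTowerBase 𝔎.carrier) 𝔖 (piecesParamsOf S 𝔎.carrier) k hκ hC25 hact h324 hC₂ (by omega)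
    𝔎.F.κ₀_pos hr₀ hR₁ (AlphaCumulant.rem_pieces 𝔎 X k) rfl (nblk_cube_le_sites 𝔎 k (by omega)) hG h25

open Classical in
/-- **Row C4 AT THE LANE'S PIECES from the source-faithful (3.24) row** — twin of `AlphaCumulant.cumulantLower_pieces` (`C₁' = 0 + C25·K₀·e^{−R₁} + C₂`).
[cite: Balaban1985UV3, (37) p.265 + p.272 + (59) p.270; Balaban1982Higgs1, (3.24) p.616] -/
theorem cumulantLower_pieces_of_eq324 (hk : k + 1 ≤ S.K) (hμ : IsProbabilityMeasure (𝔖 k).μ) {κ C25 : ℝ}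
    (hκ : kappa₀ (4 * 2 ^ 3) (2 * 3) + 1 ≤ κ) (hC25 : 0 ≤ C25) (hr₀ : 1 ≤ 𝔎.F.r₀) (hR₁ : 6 + 2 * 𝔎.F.κ₀ ≤ 𝔎.F.R₁)
    {C₂₃ c M₁ δ₀ : ℝ} {nbar : ℕ} {C₂ : ℝ} (hC₂ : 0 ≤ C₂)
    (hC₁' : 𝔎.sc.C₁' = 0 + C25 * K₀ (4 * 2 ^ 3) (2 * 3) * Real.exp (-𝔎.F.R₁) + C₂)
    (hact : ∀ h Y U, ((𝔖 k).Gt h).activities.act Y U = (𝔖 k).act h Y U)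
    (h324 : ∀ h (U : GaugeField S.P (k + 1) G),
      Eq324 (∫ ω in (𝔖 k).box h, Real.exp ((𝔖 k).𝒱 h U ω) ∂(𝔖 k).μ) ((𝔖 k).cum h U) nbar C₂
        ((L : ℝ) ^ k * S.g0sq) (3 + 𝔎.F.κ₀) (S.sites k))
    (hG : ∀ h, GraphRep23AsCited ((𝔖 k).Gt h) (fun U => ∑ n ∈ Finset.Icc 1 nbar, (𝔖 k).cum h U n / (n ! : ℝ)) C₂₃ c M₁ δ₀)
    (h25 : ∀ h, Bound25Printed ⟨(tsys 3 (𝔖 k).Nblk).Dom, GaugeField S.P (k + 1) G, (tsys 3 (𝔖 k).Nblk).dj, (𝔖 k).act h⟩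
      (S.gk k) κ C25) :
    CumulantLower (pieces 𝔎 X 𝔖 k) 𝔎.sc.C₁' := by
  haveI := hμ
  rw [hC₁']
  exact cumulantLower_series_std_of_eq324 (X.toTowerBase 𝔎.carrier) 𝔖 (piecesParamsOf S 𝔎.carrier) k hκ hC25 hact h324 hC₂ (by omega)
    𝔎.F.κ₀_pos hr₀ hR₁ (AlphaCumulant.rem_pieces 𝔎 X k) rfl (nblk_cube_le_sites 𝔎 k (by omega)) hG h25

end Pieces
/-! ## §3 (v1.1, seat dag-n08-w4 INTENT-2) The same four suppliers with NO measure-theoretic input (`_core` forms): the printed (3.24) row is a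
sentence about the NUMBER `∫_{box} e^{𝒱} dμ` and the cumulants, so rows C3∕C4 follow by real arithmetic alone; the v1 forms' `IsProbabilityMeasure (𝔖 k).μ`
binder ∕ `hμ` slot (inherited from the lane's tilted-currency theorems, where Taylor–Lagrange needs it) was never used and is dropped here.  Proofs verbatim. -/
section SeriesCore

variable {S : Scales L} {G : Type} [GaugeGroup G] [MeasurableSpace G] [HaarData G]
  {V : Type} [NormedAddCommGroup V] [NormedSpace ℂ V] {Nc : ℕ → ℕ} [∀ k, NeZero (Nc k)]

/-- **Row C3 at `seriesPieces` from ONE `Eq324` row, NO measure-theoretic input** (v1 form minus the idle binder). [cite: Balaban1985UV3, (24) p.262 + (58)–(59) p.270] -/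
theorem cumulant58_series_std_of_eq324_core (B : TowerBase S G) (𝔖 : ∀ k, StepSeries S G V (Nc k) k) (Cp : ∀ k, PiecesParams S k) (k : ℕ)
    [DecidableEq (tsys 3 (𝔖 k).Nblk).Dom] {κ C : ℝ}
    (hκ : kappa₀ (4 * 2 ^ 3) (2 * 3) + 1 ≤ κ) (hC : 0 ≤ C) {C₂₃ c M₁ δ₀ : ℝ}
    (hact : ∀ h X U, ((𝔖 k).Gt h).activities.act X U = (𝔖 k).act h X U) {nbar : ℕ} {C₂ : ℝ}
    (h324 : ∀ h (U : GaugeField S.P (k + 1) G),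
      Eq324 (∫ ω in (𝔖 k).box h, Real.exp ((𝔖 k).𝒱 h U ω) ∂(𝔖 k).μ) ((𝔖 k).cum h U) nbar C₂
        ((L : ℝ) ^ k * S.g0sq) (3 + B.κ₀) (S.sites k))
    (hC₂ : 0 ≤ C₂) (hk : k ≤ S.K) (hκ₀ : 0 < B.κ₀) {r₀ R₁ : ℝ} (hr₀ : 1 ≤ r₀) (hR₁ : 6 + 2 * B.κ₀ ≤ R₁)
    (hrem : (Cp k).rem = ((L : ℝ) ^ k * S.g0sq) ^ (3 + B.κ₀) * S.sites k)
    (hRret : B.Rret k = R₁ * B10.rFun r₀ (S.gk k))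
    (hblocks : ((𝔖 k).Nblk : ℝ) ^ 3 ≤ S.sites k)
    (hG : ∀ h, GraphRep23AsCited ((𝔖 k).Gt h) (fun U => ∑ n ∈ Finset.Icc 1 nbar, (𝔖 k).cum h U n / (n ! : ℝ))
      C₂₃ c M₁ δ₀)
    (h25 : ∀ h, B10.Bound25Printed
      ⟨(tsys 3 (𝔖 k).Nblk).Dom, GaugeField S.P (k + 1) G, (tsys 3 (𝔖 k).Nblk).dj, (𝔖 k).act h⟩ (S.gk k) κ C) :
    Cumulant58 (seriesPieces B 𝔖 Cp k) (C * K₀ (4 * 2 ^ 3) (2 * 3))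
      (0 + C * K₀ (4 * 2 ^ 3) (2 * 3) * Real.exp (-R₁) + C₂) := by
  have hZ : ∀ h, (((Finset.univ : Finset (tcubeSys 3 (𝔖 k).Nblk).Cube) \ ΩblkOf (P := S.P) B.M₁ B.Rcol (Nc k) h).card : ℝ)
      ≤ (seriesPieces B 𝔖 Cp k).Zvol h := fun h => by
    show _ ≤ ((ZVol B.M₁ B.Rcol (k + 1) h k : ℕ) : ℝ)
    exact_mod_cast card_compl_ΩblkOf_le_ZVol (P := S.P) B.M₁ B.Rcol (Nc k) h
  have hg : 0 < S.gk k := gk_pos S k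
  have hg1 : S.gk k ≤ 1 := gk_le_one S S.gK_le_one k hk
  have hK₀ : 0 ≤ K₀ (4 * 2 ^ 3) (2 * 3) := (B12TreeDecay.K₀_pos _ _).le
  have hR : 0 ≤ B.Rret k := by
    rw [hRret]; exact mul_nonneg (by linarith) (VacuumAndBooking.rFun_nonneg r₀ (S.gk k) hg hg1)
  have hlarge : (C * S.gk k * K₀ (4 * 2 ^ 3) (2 * 3) * ((𝔖 k).Nblk : ℝ) ^ 3) * Real.exp (-B.Rret k) ≤
      (C * K₀ (4 * 2 ^ 3) (2 * 3) * Real.exp (-R₁)) * (Cp k).rem := by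
    have h := largeLoc_le_normRem S (r₀ := r₀) (R₁ := R₁) (κ₀ := B.κ₀) (A := C * K₀ (4 * 2 ^ 3) (2 * 3))
      (vol := ((𝔖 k).Nblk : ℝ) ^ 3) k hk hr₀ (by linarith) (by linarith) (mul_nonneg hC hK₀) (by positivity) hblocks
    rw [hRret, hrem, ScalesArithmetic.norm_rem_eq]
    calc C * S.gk k * K₀ (4 * 2 ^ 3) (2 * 3) * ((𝔖 k).Nblk : ℝ) ^ 3 * Real.exp (-(R₁ * B10.rFun r₀ (S.gk k)))
        = C * K₀ (4 * 2 ^ 3) (2 * 3) * S.gk k * ((𝔖 k).Nblk : ℝ) ^ 3 * Real.exp (-(R₁ * B10.rFun r₀ (S.gk k))) := by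
          ring
      _ ≤ C * K₀ (4 * 2 ^ 3) (2 * 3) * Real.exp (-R₁) * ((S.gk k ^ 2) ^ (3 + B.κ₀) * S.sites k) := h
  have hlogFl : ∀ (h : Hist S.P (k + 1)) (U : GaugeField S.P (k + 1) G), (seriesPieces B 𝔖 Cp k).logFl h U =
      Real.log (∫ ω in (𝔖 k).box h, Real.exp ((𝔖 k).𝒱 h U ω) ∂(𝔖 k).μ) := fun _ _ => rfl
  have hPprU : ∀ (h : Hist S.P (k + 1)) (U : GaugeField S.P (k + 1) G), (seriesPieces B 𝔖 Cp k).PprU h U =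
      ∑ X ∈ Finset.univ.filter (fun X : (tsys 3 (𝔖 k).Nblk).Dom =>
        (tcubeSys 3 (𝔖 k).Nblk).cubes X ⊆ ΩblkOf (P := S.P) B.M₁ B.Rcol (Nc k) h ∧ (tsys 3 (𝔖 k).Nblk).dj X < B.Rret k),
          (𝔖 k).act h X U := fun _ _ => rfl
  exact cumulant58_of_graphRep23' (𝔖 k).Nblk (seriesPieces B 𝔖 Cp k) hκ (𝔖 k).Gt (𝔖 k).act hact
    (fun h U => ∫ ω in (𝔖 k).box h, Real.exp ((𝔖 k).𝒱 h U ω) ∂(𝔖 k).μ) (𝔖 k).cum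
    (fun h => ΩblkOf (P := S.P) B.M₁ B.Rcol (Nc k) h) hG h25
    (fun h U => by rw [hlogFl h U, zero_mul, add_zero]) h324 hC₂ (le_of_eq hrem.symm) hR (mul_nonneg hC hg.le)
    (fun h U => by rw [hPprU h U, sum_filter_and_eq]) hZ hlarge

/-- **Row C4 at `seriesPieces` from ONE `Eq324` row, NO measure-theoretic input** (v1 form minus the idle binder). [cite: Balaban1985UV3, (37) p.265 + p.272 + (59) p.270] -/
theorem cumulantLower_series_std_of_eq324_core (B : TowerBase S G) (𝔖 : ∀ k, StepSeries S G V (Nc k) k) (Cp : ∀ k, PiecesParams S k) (k : ℕ)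
    [DecidableEq (tsys 3 (𝔖 k).Nblk).Dom] {κ C : ℝ}
    (hκ : kappa₀ (4 * 2 ^ 3) (2 * 3) + 1 ≤ κ) (hC : 0 ≤ C) {C₂₃ c M₁ δ₀ : ℝ}
    (hact : ∀ h X U, ((𝔖 k).Gt h).activities.act X U = (𝔖 k).act h X U) {nbar : ℕ} {C₂ : ℝ}
    (h324 : ∀ h (U : GaugeField S.P (k + 1) G),
      Eq324 (∫ ω in (𝔖 k).box h, Real.exp ((𝔖 k).𝒱 h U ω) ∂(𝔖 k).μ) ((𝔖 k).cum h U) nbar C₂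
        ((L : ℝ) ^ k * S.g0sq) (3 + B.κ₀) (S.sites k))
    (hC₂ : 0 ≤ C₂) (hk : k ≤ S.K) (hκ₀ : 0 < B.κ₀) {r₀ R₁ : ℝ} (hr₀ : 1 ≤ r₀) (hR₁ : 6 + 2 * B.κ₀ ≤ R₁)
    (hrem : (Cp k).rem = ((L : ℝ) ^ k * S.g0sq) ^ (3 + B.κ₀) * S.sites k)
    (hRret : B.Rret k = R₁ * B10.rFun r₀ (S.gk k))
    (hblocks : ((𝔖 k).Nblk : ℝ) ^ 3 ≤ S.sites k)
    (hG : ∀ h, GraphRep23AsCited ((𝔖 k).Gt h) (fun U => ∑ n ∈ Finset.Icc 1 nbar, (𝔖 k).cum h U n / (n ! : ℝ))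
      C₂₃ c M₁ δ₀)
    (h25 : ∀ h, B10.Bound25Printed
      ⟨(tsys 3 (𝔖 k).Nblk).Dom, GaugeField S.P (k + 1) G, (tsys 3 (𝔖 k).Nblk).dj, (𝔖 k).act h⟩ (S.gk k) κ C) :
    CumulantLower (seriesPieces B 𝔖 Cp k) (0 + C * K₀ (4 * 2 ^ 3) (2 * 3) * Real.exp (-R₁) + C₂) := by
  have hZ : ∀ h, (((Finset.univ : Finset (tcubeSys 3 (𝔖 k).Nblk).Cube) \ ΩblkOf (P := S.P) B.M₁ B.Rcol (Nc k) h).card : ℝ)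
      ≤ (seriesPieces B 𝔖 Cp k).Zvol h := fun h => by
    show _ ≤ ((ZVol B.M₁ B.Rcol (k + 1) h k : ℕ) : ℝ)
    exact_mod_cast card_compl_ΩblkOf_le_ZVol (P := S.P) B.M₁ B.Rcol (Nc k) h
  have hg : 0 < S.gk k := gk_pos S k
  have hg1 : S.gk k ≤ 1 := gk_le_one S S.gK_le_one k hk
  have hK₀ : 0 ≤ K₀ (4 * 2 ^ 3) (2 * 3) := (B12TreeDecay.K₀_pos _ _).le
  have hR : 0 ≤ B.Rret k := by
    rw [hRret]; exact mul_nonneg (by linarith) (VacuumAndBooking.rFun_nonneg r₀ (S.gk k) hg hg1)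
  have hlarge : (C * S.gk k * K₀ (4 * 2 ^ 3) (2 * 3) * ((𝔖 k).Nblk : ℝ) ^ 3) * Real.exp (-B.Rret k) ≤
      (C * K₀ (4 * 2 ^ 3) (2 * 3) * Real.exp (-R₁)) * (Cp k).rem := by
    have h := largeLoc_le_normRem S (r₀ := r₀) (R₁ := R₁) (κ₀ := B.κ₀) (A := C * K₀ (4 * 2 ^ 3) (2 * 3))
      (vol := ((𝔖 k).Nblk : ℝ) ^ 3) k hk hr₀ (by linarith) (by linarith) (mul_nonneg hC hK₀) (by positivity) hblocks
    rw [hRret, hrem, ScalesArithmetic.norm_rem_eq]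
    calc C * S.gk k * K₀ (4 * 2 ^ 3) (2 * 3) * ((𝔖 k).Nblk : ℝ) ^ 3 * Real.exp (-(R₁ * B10.rFun r₀ (S.gk k)))
        = C * K₀ (4 * 2 ^ 3) (2 * 3) * S.gk k * ((𝔖 k).Nblk : ℝ) ^ 3 * Real.exp (-(R₁ * B10.rFun r₀ (S.gk k))) := by
          ring
      _ ≤ C * K₀ (4 * 2 ^ 3) (2 * 3) * Real.exp (-R₁) * ((S.gk k ^ 2) ^ (3 + B.κ₀) * S.sites k) := h
  have hlogFl : ∀ (h : Hist S.P (k + 1)) (U : GaugeField S.P (k + 1) G), (seriesPieces B 𝔖 Cp k).logFl h U =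
      Real.log (∫ ω in (𝔖 k).box h, Real.exp ((𝔖 k).𝒱 h U ω) ∂(𝔖 k).μ) := fun _ _ => rfl
  have hPprU : ∀ (h : Hist S.P (k + 1)) (U : GaugeField S.P (k + 1) G), (seriesPieces B 𝔖 Cp k).PprU h U =
      ∑ X ∈ Finset.univ.filter (fun X : (tsys 3 (𝔖 k).Nblk).Dom =>
        (tcubeSys 3 (𝔖 k).Nblk).cubes X ⊆ ΩblkOf (P := S.P) B.M₁ B.Rcol (Nc k) h ∧ (tsys 3 (𝔖 k).Nblk).dj X < B.Rret k),
          (𝔖 k).act h X U := fun _ _ => rfl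
  exact cumulantLower_torus (𝔖 k).Nblk (seriesPieces B 𝔖 Cp k) hκ
    (fun h U => ∫ ω in (𝔖 k).box h, Real.exp ((𝔖 k).𝒱 h U ω) ∂(𝔖 k).μ) (𝔖 k).cum (𝔖 k).act
    (fun h => ΩblkOf (P := S.P) B.M₁ B.Rcol (Nc k) h)
    (fun U => by rw [hlogFl, zero_mul, sub_zero]) (fun U => h324 _ U) hC₂ (le_of_eq hrem.symm) hR (mul_nonneg hC hg.le) h25
    (fun h U => by rw [(hG h).cum_eq_sum_activities U]; exact Finset.sum_congr rfl fun X _ => hact h X U)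
    (fun h U => by rw [hPprU h U, sum_filter_and_eq]) hZ hlarge

end SeriesCore
section PiecesCore

variable (𝔎 : LaneConsts L) {S : Scales L} {G : Type} [GaugeGroup G] [MeasurableSpace G] [HaarData G]
  {V : Type} [NormedAddCommGroup V] [NormedSpace ℂ V]
  (X : ExternalInputs S G) (𝔖 : ∀ k, StepSeries S G V (nblkOf S 𝔎.carrier k) k) (k : ℕ)

open Classical in
/-- **Row C3 AT THE LANE'S PIECES from ONE `Eq324` row, NO measure-theoretic input** (v1 form minus the idle `hμ`). [cite: Balaban1985UV3, (24) p.262 + (58)–(59) p.270] -/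
theorem cumulant58_pieces_of_eq324_core (hk : k + 1 ≤ S.K) {κ C25 : ℝ}
    (hκ : kappa₀ (4 * 2 ^ 3) (2 * 3) + 1 ≤ κ) (hC25 : 0 ≤ C25) (hr₀ : 1 ≤ 𝔎.F.r₀) (hR₁ : 6 + 2 * 𝔎.F.κ₀ ≤ 𝔎.F.R₁)
    {C₂₃ c M₁ δ₀ : ℝ} {nbar : ℕ} {C₂ : ℝ} (hC₂ : 0 ≤ C₂)
    (hCz : 𝔎.sc.Cz = C25 * K₀ (4 * 2 ^ 3) (2 * 3))
    (hC₁ : 𝔎.sc.C₁ = 0 + C25 * K₀ (4 * 2 ^ 3) (2 * 3) * Real.exp (-𝔎.F.R₁) + C₂)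
    (hact : ∀ h Y U, ((𝔖 k).Gt h).activities.act Y U = (𝔖 k).act h Y U)
    (h324 : ∀ h (U : GaugeField S.P (k + 1) G),
      Eq324 (∫ ω in (𝔖 k).box h, Real.exp ((𝔖 k).𝒱 h U ω) ∂(𝔖 k).μ) ((𝔖 k).cum h U) nbar C₂
        ((L : ℝ) ^ k * S.g0sq) (3 + 𝔎.F.κ₀) (S.sites k))
    (hG : ∀ h, GraphRep23AsCited ((𝔖 k).Gt h) (fun U => ∑ n ∈ Finset.Icc 1 nbar, (𝔖 k).cum h U n / (n ! : ℝ)) C₂₃ c M₁ δ₀)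
    (h25 : ∀ h, Bound25Printed ⟨(tsys 3 (𝔖 k).Nblk).Dom, GaugeField S.P (k + 1) G, (tsys 3 (𝔖 k).Nblk).dj, (𝔖 k).act h⟩
      (S.gk k) κ C25) :
    Cumulant58 (pieces 𝔎 X 𝔖 k) 𝔎.sc.Cz 𝔎.sc.C₁ := by
  rw [hCz, hC₁]
  exact cumulant58_series_std_of_eq324_core (X.toTowerBase 𝔎.carrier) 𝔖 (piecesParamsOf S 𝔎.carrier) k hκ hC25 hact h324 hC₂ (by omega)
    𝔎.F.κ₀_pos hr₀ hR₁ (AlphaCumulant.rem_pieces 𝔎 X k) rfl (nblk_cube_le_sites 𝔎 k (by omega)) hG h25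

open Classical in

open Classical in
/-- **Row C4 AT THE LANE'S PIECES from ONE `Eq324` row, NO measure-theoretic input** (v1 form minus the idle `hμ`). [cite: Balaban1985UV3, (37) p.265 + p.272 + (59) p.270] -/
theorem cumulantLower_pieces_of_eq324_core (hk : k + 1 ≤ S.K) {κ C25 : ℝ}
    (hκ : kappa₀ (4 * 2 ^ 3) (2 * 3) + 1 ≤ κ) (hC25 : 0 ≤ C25) (hr₀ : 1 ≤ 𝔎.F.r₀) (hR₁ : 6 + 2 * 𝔎.F.κ₀ ≤ 𝔎.F.R₁)
    {C₂₃ c M₁ δ₀ : ℝ} {nbar : ℕ} {C₂ : ℝ} (hC₂ : 0 ≤ C₂)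
    (hC₁' : 𝔎.sc.C₁' = 0 + C25 * K₀ (4 * 2 ^ 3) (2 * 3) * Real.exp (-𝔎.F.R₁) + C₂)
    (hact : ∀ h Y U, ((𝔖 k).Gt h).activities.act Y U = (𝔖 k).act h Y U)
    (h324 : ∀ h (U : GaugeField S.P (k + 1) G),
      Eq324 (∫ ω in (𝔖 k).box h, Real.exp ((𝔖 k).𝒱 h U ω) ∂(𝔖 k).μ) ((𝔖 k).cum h U) nbar C₂
        ((L : ℝ) ^ k * S.g0sq) (3 + 𝔎.F.κ₀) (S.sites k))
    (hG : ∀ h, GraphRep23AsCited ((𝔖 k).Gt h) (fun U => ∑ n ∈ Finset.Icc 1 nbar, (𝔖 k).cum h U n / (n ! : ℝ)) C₂₃ c M₁ δ₀)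
    (h25 : ∀ h, Bound25Printed ⟨(tsys 3 (𝔖 k).Nblk).Dom, GaugeField S.P (k + 1) G, (tsys 3 (𝔖 k).Nblk).dj, (𝔖 k).act h⟩
      (S.gk k) κ C25) :
    CumulantLower (pieces 𝔎 X 𝔖 k) 𝔎.sc.C₁' := by
  rw [hC₁']
  exact cumulantLower_series_std_of_eq324_core (X.toTowerBase 𝔎.carrier) 𝔖 (piecesParamsOf S 𝔎.carrier) k hκ hC25 hact h324 hC₂ (by omega)
    𝔎.F.κ₀_pos hr₀ hR₁ (AlphaCumulant.rem_pieces 𝔎 X k) rfl (nblk_cube_le_sites 𝔎 k (by omega)) hG h25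

end PiecesCore
end Summit.QuantumFields.YangMills.Theorems.BalabanUVNodesN08AlphaEq324RowSuppliers

end
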